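import Literature.AlgebraicGeometry.Frobenioids.ArchimedeanBiratNormalized
import Literature.AlgebraicGeometry.Frobenioids.ArchimedeanQuasiIsotropic
import Literature.AlgebraicGeometry.Frobenioids.ArchimedeanStandardType
import Literature.AlgebraicGeometry.Frobenioids.ArchimedeanFrobeniusIsotropic
import Literature.AlgebraicGeometry.Frobenioids.Thm36SubRlfFrobenioid
import Literature.AlgebraicGeometry.Frobenioids.BiratFrobeniusCompactCriterion
import Literature.AlgebraicGeometry.Frobenioids.PerfectionRationallyStandardHolds
import Literature.AlgebraicGeometry.Frobenioids.PerfectionIsFrobenioid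
import Literature.AlgebraicGeometry.Frobenioids.Prop55SubRatStdRlfHolds
import Literature.AlgebraicGeometry.Frobenioids.BaseIdentityPreStepsSlim
import HarnessLib

/-!
# Frobenioids II, Theorem 3.6 (i), last clause: "if `D` is of FSMFF- and RC-iso-subanchor type, then `C^Λ`
# is of rationally standard type" — PROVED AT THE PARAMETERS of [FrdI] Def. 4.5 (iii), all `Λ ∈ {ℤ, ℚ, ℝ}`

Mochizuki, *The geometry of Frobenioids II: poly-Frobenioids*, Kyushu J. Math. **62** (2008)
401–460, §3, Theorem 3.6 (i), kurims text p. 36 (last sentence of (i)) with its proof p. 38 ll. 14–30: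
"it is immediate from the construction of `C^Λ` that `C^Λ` is of metrically trivial, [strictly] rational,
and birationally Frobenius-normalized type … it is immediate from the construction of `C^ℝ` that every
object of `((C^Λ)^un-tr)^birat = (C^ℝ)^birat` is Frobenius-compact. Thus, if, moreover, `D` is of FSMFF- and
RC-iso-subanchor type, then, [since `Φ` is manifestly non-dilating] to complete the proof of assertion (i),
it suffices to observe that by Proposition 3.5, (ii), `C` is of quasi-isotropic type."
[cite: MochizukiFrdII2008, Thm 3.6 (i) p.36]

PROOF-ONLY (no `def`; cell abc-iut, layer L1, seat abc-iut-L1-t9 = typer of the schema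
`ArchFrd.Thm36i_rationallyStandard G F R` of `ArchimedeanStandardType.lean`, sub-DAG row T36-L06; residual
#2 of abc-iut-w4-d092's M16 census).  The schema binds the Def. 4.5 (iii) parameter bundle `R` freely; the
printed claim is its value at THE parameters `PreFrobenioid.rsParams hF PrimarySupp` (`Prop55Sub.lean`:
THE birationalization, THE unit-trivialisation and ITS birationalization; `PrimarySupp` = the support
predicate of [FrdI] Def. 2.4 (i)(d) read on primary elements, as everywhere in the cell).
* `Λ = ℤ` (`C^ℤ = C`), over every connected, totally epimorphic base `π : D → D₀` (Ex. 3.3 (i)), with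
  `hF :=` "`C` is a Frobenioid" (Ex. 3.3 (ii), `Ex33ii_isFrobenioid_holds`): clause by clause of Def. 4.5
  (iii) — (a) birationally Frobenius-normalized: `C.isOfBiratFrobeniusNormalizedType`
  (`ArchimedeanBiratNormalized.lean`); (a) rational: `C.isRational_rsParams` (every object is strictly
  rational: `Φ^birat = Φ^gp` for `C`, abc-iut-w4-d074's `Thm36Sub.biratSubfunctor_carrier_eq_top`, and
  `ℝ_{≥0}` is sharp); (a) standard: abc-iut-w4-d092's `C.isOfStandardType` (Prop. 3.5 (ii) inside);
  (b) `C.exists_isFrobeniusCompact_untrBirat`: a Frobenius-compact object of `(C^un-tr)^birat` by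
  abc-iut-L6-t10's criterion `Birat.exists_isFrobeniusCompact_untrBirat_of_invariant` at the isotropic object
  of tip `1` over any `X ∈ Ob(D)` and the divisor `1 ∈ ℝ_{≥0}` (non-torsion; invariant since `Φ` has
  identity transition maps) — assembled in **`thm36i_rationallyStandard_C`**.
* `Λ = ℚ` (`C^ℚ := C^pf`, Ex. 3.3 (ii)) and `Λ = ℝ` (`C^ℝ := C^rlf`) at THE completions of
  `Thm36Sub.lean` (`pfStr`, `rlfStr`) by [FrdI] Prop. 5.5 (iii) ("if `C` is of rationally standard type,
  then so is `C^pf`"; "`C` not group-like … then so are `C^un-tr`, `C^rlf`"), whose tree closers are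
  `FrdI.Prop55Sub.prop55iii_pf_ratStd_holds` (abc-iut perfection chain) and
  `FrdI.Prop55Sub.prop55iii_untr_rlf_ratStd'_holds` (abc-iut-w5-d250 / w4-d084 / L1-t2), with the
  Frobenioid structures of `C^pf` ([FrdI] Prop. 3.2 (iii), `Perfection.isFrobenioid`) and `C^rlf`
  (abc-iut-w4-d074's `Thm36Sub.rlf_isFrobenioid`): **`thm36i_rationallyStandard_pf`**,
  **`thm36i_rationallyStandard_rlf`**.
Hypotheses left: none beyond Ex. 3.3 (i)'s standing "`D` connected, totally epimorphic" and the printed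
"`D` of FSMFF- and RC-iso-subanchor type" (antecedent of the schema).  No statement of the paper is
strengthened; nothing here bears on [IUTchIII] Cor. 3.12.
-/

noncomputable section

namespace Literature.AlgebraicGeometry.Frobenioids

open CategoryTheory Opposite
open scoped NNReal

universe v u

namespace ArchFrd

variable {D : Type u} [Category.{v} D] (π : D ⥤ D0)

/-! ### (a) rational: every object of `C` is strictly rational w.r.t. THE `(C^birat, Supp)` -/

/-- **Every object of `C` is strictly rational** ([FrdI] Def. 4.5 (ii)) w.r.t. THE birationalization and
the canonical support: for a prime `𝔭` of `Φ(A_D) = ℝ_{≥0}` with representative `a₀`, the pair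
`(a, b) := (a₀, 0)` works — `a₀ − 0 ∈ Φ^birat(A_D) = Φ(A_D)^gp` (abc-iut-w4-d074's
`Thm36Sub.biratSubfunctor_carrier_eq_top`), `𝔭 ∈ Supp(a₀)`, `𝔭 ∉ Supp(0)` (`ℝ_{≥0}` is sharp).
[cite: MochizukiFrdII2008, Thm 3.6 (i) p.36] -/
theorem C.isStrictlyRational_rsParams (hF : PreFrobenioid.IsFrobenioid (C.toElem π)) (A : C π) :
    PreFrobenioidData.IsStrictlyRational
      (PreFrobenioid.rsParams hF fun a 𝔭 => PrimarySupp a 𝔭).B (fun a 𝔭 => PrimarySupp a 𝔭) A := by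
  intro 𝔭
  obtain ⟨⟨a₀, ha₀⟩, rfl⟩ := Quotient.exists_rep 𝔭
  refine ⟨a₀, 1, ?_, ⟨a₀, ha₀, rfl, precsim_refl a₀⟩, ?_⟩
  · change _ ∈ (PreFrobenioid.biratSubfunctor (C.toElem π)).carrier _
    rw [Thm36Sub.biratSubfunctor_carrier_eq_top]
    exact Subgroup.mem_top _
  · rintro ⟨a₁, ha₁, -, n, -, hdvd⟩
    rw [one_pow] at hdvd
    exact ha₁.1 (isSharp_nnreal.1 a₁ (isUnit_of_dvd_one hdvd))

/-- **Every object of `C` is rational** ([FrdI] Def. 4.5 (ii); pull-back morphism `= id`).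
[cite: MochizukiFrdII2008, Thm 3.6 (i) p.36] -/
theorem C.isRational_rsParams (hF : PreFrobenioid.IsFrobenioid (C.toElem π)) (A : C π) :
    PreFrobenioidData.IsRational
      (PreFrobenioid.rsParams hF fun a 𝔭 => PrimarySupp a 𝔭).B (fun a 𝔭 => PrimarySupp a 𝔭) A :=
  ⟨A, 𝟙 A, PreFrobenioidData.isPullbackMorphism_id _ A, C.isStrictlyRational_rsParams π hF A⟩

/-! ### (b) a Frobenius-compact object of `(C^un-tr)^birat` -/

/-- **"Every object of `((C^Λ)^un-tr)^birat = (C^ℝ)^birat` is Frobenius-compact" (FrdII p. 38 l. 27),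
the instance needed for Def. 4.5 (iii)(b)**: over any `X ∈ Ob(D)`, the image in `(C^un-tr)^birat` of the
isotropic object of tip `1` over `X` is Frobenius-compact — abc-iut-L6-t10's criterion at the divisor
`d₀ = 1 ∈ ℝ_{≥0} = Φ(X)` (in `Φ^birat(X) = Φ(X)^gp`, non-torsion, and invariant under every base map
because the transition maps of `Φ = Φ₀|_D` are identities). [cite: MochizukiFrdII2008, Thm 3.6 (i) p.36] -/
theorem C.exists_isFrobeniusCompact_untrBirat (hF : PreFrobenioid.IsFrobenioid (C.toElem π)) (X : D) :
    ∃ Y : (PreFrobenioid.rsParams hF fun a 𝔭 => PrimarySupp a 𝔭).BU.Birat,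
      (PreFrobenioid.rsParams hF fun a 𝔭 => PrimarySupp a 𝔭).BU.ops.IsFrobeniusCompact Y := by
  -- the isotropic object of tip `1` over `X`, as an object of `C^un-tr`
  have hiso : (PreFrobenioidData.ofFunctor (Φ π) (C.toElem π)).IsIsotropic (unitObjOver π X) :=
    (PreFrobenioidData.ofFunctor_isIsotropic _ _).mpr (Thm36Sub.isIsotropic_unitObjOver π X)
  let A : (PreFrobenioidData.ofFunctor (Φ π) (C.toElem π)).Untr := { as := ⟨unitObjOver π X, hiso⟩ }
  -- the divisor `d₀ = 1 ∈ ℝ_{≥0}` (written multiplicatively: `ofAdd 1`)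
  let a : (Φ π).obj (op X) := Multiplicative.ofAdd (1 : ℝ≥0)
  refine PreFrobenioid.Birat.exists_isFrobeniusCompact_untrBirat_of_invariant hF A
    (Algebra.GrothendieckGroup.of a) ?_ ?_ ?_
  · -- `Φ^birat(X) = Φ(X)^gp`
    change _ ∈ (PreFrobenioid.biratSubfunctor (C.toElem π)).carrier X
    rw [Thm36Sub.biratSubfunctor_carrier_eq_top]
    exact Subgroup.mem_top _
  · -- non-torsion: `N · 1 ≠ 0` in `ℝ_{≥0}`
    intro N hN h
    haveI : IsCancelMul ((Φ π).obj (op X)) := isIntegral_iff_isCancelMul.mp isIntegral_nnreal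
    have hinj : Function.Injective (Algebra.GrothendieckGroup.of (M := (Φ π).obj (op X))) :=
      Algebra.GrothendieckGroup.of_injective
    have h' : a ^ N = 1 := hinj (by rw [map_pow, map_one]; exact h)
    change (Multiplicative.ofAdd (1 : ℝ≥0)) ^ N = (1 : Multiplicative ℝ≥0) at h'
    have h'' : N • (1 : ℝ≥0) = 0 := by
      have := congrArg Multiplicative.toAdd h'
      rwa [toAdd_pow, toAdd_one, toAdd_ofAdd] at this
    rw [nsmul_eq_mul, mul_one, Nat.cast_eq_zero] at h''
    omega
  · -- invariance: the transition maps of `Φ` are identities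
    intro f
    rw [pullGp_of, Thm36Sub.Φ_map_eq_id]
    rfl

/-! ### Theorem 3.6 (i), last clause, `Λ = ℤ` -/

/-- **`C` (`= C^ℤ`) is of rationally standard type w.r.t. THE parameters of Def. 4.5 (iii)** over a
connected, totally epimorphic base `D` of FSMFF- and RC-iso-subanchor type — all four clauses discharged.
[cite: MochizukiFrdII2008, Thm 3.6 (i) p.36] -/
theorem C.isOfRationallyStandardType_rsParams (hconn : IsGraphConnected D) (hTE : IsTotallyEpimorphic D)
    (hD : IsOfFSMFFType D) (hrc : RC.IsOfRCIsoSubanchorType (baseRC π)) :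
    (PreFrobenioidData.ofFunctor (Φ π) (C.toElem π)).IsOfRationallyStandardType
      (PreFrobenioid.rsParams (Ex33ii_isFrobenioid_holds π hconn hTE) fun a 𝔭 => PrimarySupp a 𝔭) := by
  obtain ⟨X⟩ := hconn.nonempty
  exact
    { biratFrobNormalized := C.isOfBiratFrobeniusNormalizedType π _ _
      rational := C.isRational_rsParams π _
      standard := C.isOfStandardType π hconn hTE hD hrc
      frobCompact := C.exists_isFrobeniusCompact_untrBirat π _ X }

/-- **[FrdII] Theorem 3.6 (i), last clause, `Λ = ℤ` — PROVED AT THE PARAMETERS**: over every connected,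
totally epimorphic base `π : D → D₀` (Ex. 3.3 (i)), "if, moreover, `D` is of FSMFF- and RC-iso-subanchor
type, then `C` is of rationally standard type" — abc-iut-L1-t9's typed clause `Thm36i_rationallyStandard`
at the archimedean Frobenioid `C → F_Φ` and THE Def. 4.5 (iii) parameters
`PreFrobenioid.rsParams hF PrimarySupp`, `hF :=` Ex. 3.3 (ii) (discharged). [cite: MochizukiFrdII2008, Thm 3.6 (i) p.36] -/
theorem thm36i_rationallyStandard_C (hconn : IsGraphConnected D) (hTE : IsTotallyEpimorphic D) :
    Thm36i_rationallyStandard (baseRC π) (C.toElem π)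
      (PreFrobenioid.rsParams (Ex33ii_isFrobenioid_holds π hconn hTE) fun a 𝔭 => PrimarySupp a 𝔭) :=
  fun hD hrc => C.isOfRationallyStandardType_rsParams π hconn hTE hD hrc

/-! ### Theorem 3.6 (i), last clause, `Λ = ℚ` and `Λ = ℝ` (at THE completions `C^pf`, `C^rlf`) -/

/-- `C` is not of group-like type (functor form; `Φ(X) = ℝ_{≥0}` is not a group), given an object of `D`.
[cite: MochizukiFrdII2008, Thm 3.6 (i) p.36] -/
theorem C.not_isOfType_isGroupLikeObj (X : D) :
    ¬ PreFrobenioid.IsOfType (PreFrobenioid.IsGroupLikeObj (C.toElem π)) := fun h =>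
  C.not_isOfGroupLikeType π (unitObjOver π X)
    ⟨fun A => (PreFrobenioidData.ofFunctor_isGroupLikeObj _ A).mpr (h A)⟩

/-- **`C^pf` is a Frobenioid** ([FrdI] Prop. 3.2 (iii), the tree's `Perfection.isFrobenioid`, at the
archimedean `C`, which is of Frobenius-isotropic type by Ex. 3.3 (ii)). [cite: MochizukiFrdII2008, Ex 3.3 (ii) p.28] -/
theorem C.pf_isFrobenioid (hF : PreFrobenioid.IsFrobenioid (C.toElem π)) :
    PreFrobenioid.IsFrobenioid (Thm36Sub.pfStr π hF) :=
  PreFrobenioid.Perfection.isFrobenioid hF (Ex33ii_frobeniusIsotropic_holds π)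

/-- **[FrdII] Theorem 3.6 (i), last clause, `Λ = ℚ` — PROVED AT THE PARAMETERS** for `C^ℚ := C^pf` (Ex. 3.3
(ii)), THE perfection of `Thm36Sub.lean` with its structure functor `pfStr π hF : C^pf → F_{Φ^pf}`: over a
connected, totally epimorphic base of FSMFF- and RC-iso-subanchor type, `C^pf` is of rationally standard
type w.r.t. `PreFrobenioid.rsParams hPf PrimarySupp` — from the case `Λ = ℤ` by [FrdI] Prop. 5.5 (iii)
(`FrdI.Prop55Sub.prop55iii_pf_ratStd_holds`). [cite: MochizukiFrdII2008, Thm 3.6 (i) p.36] -/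
theorem thm36i_rationallyStandard_pf (hconn : IsGraphConnected D) (hTE : IsTotallyEpimorphic D) :
    Thm36i_rationallyStandard (baseRC π) (Thm36Sub.pfStr π (Ex33ii_isFrobenioid_holds π hconn hTE))
      (PreFrobenioid.rsParams (C.pf_isFrobenioid π (Ex33ii_isFrobenioid_holds π hconn hTE))
        fun a 𝔭 => PrimarySupp a 𝔭) :=
  fun hD hrc =>
    FrdI.Prop55Sub.prop55iii_pf_ratStd_holds (Ex33ii_isFrobenioid_holds π hconn hTE)
      (Ex33ii_frobeniusIsotropic_holds π)
      (fun A => (C.isOfFrobeniusNormalizedType π).obj A)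
      (C.pf_isFrobenioid π _)
      (C.isOfRationallyStandardType_rsParams π hconn hTE hD hrc)

/-- **[FrdII] Theorem 3.6 (i), last clause, `Λ = ℝ` — PROVED AT THE PARAMETERS** for `C^ℝ := C^rlf` (Ex. 3.3
(ii)), THE realification of `Thm36Sub.lean` with its structure functor `rlfStr π : C^rlf → F_{Φ^rlf}` (a
Frobenioid: abc-iut-w4-d074's `Thm36Sub.rlf_isFrobenioid`): over a connected, totally epimorphic base of
FSMFF- and RC-iso-subanchor type, `C^rlf` is of rationally standard type w.r.t.
`PreFrobenioid.rsParams hR PrimarySupp` — from the case `Λ = ℤ` by [FrdI] Prop. 5.5 (iii) ("`C` not of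
group-like type … then so are `C^un-tr`, `C^rlf`"; `FrdI.Prop55Sub.prop55iii_untr_rlf_ratStd'_holds`).
[cite: MochizukiFrdII2008, Thm 3.6 (i) p.36] -/
theorem thm36i_rationallyStandard_rlf (hconn : IsGraphConnected D) (hTE : IsTotallyEpimorphic D) :
    Thm36i_rationallyStandard (baseRC π) (Thm36Sub.rlfStr π)
      (PreFrobenioid.rsParams (Thm36Sub.rlf_isFrobenioid π hconn hTE) fun a 𝔭 => PrimarySupp a 𝔭) := by
  intro hD hrc
  obtain ⟨X⟩ := hconn.nonempty
  exact (FrdI.Prop55Sub.prop55iii_untr_rlf_ratStd'_holds (C.toElem π) (Ex33ii_isFrobenioid_holds π hconn hTE)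
    (isPerfFactorialOn_Φ π) (Ex33ii_frobeniusIsotropic_holds π)
    (fun A => (C.isOfFrobeniusNormalizedType π).obj A) (C.not_isOfType_isGroupLikeObj π X)
    (C.isOfRationallyStandardType_rsParams π hconn hTE hD hrc)).2 _

/-- **The unit-trivialisation `C^un-tr` is of rationally standard type** w.r.t. THE parameters, over a
connected, totally epimorphic base of FSMFF- and RC-iso-subanchor type ([FrdI] Prop. 5.5 (iii) "then so
are `C^un-tr`, `C^rlf`"; recorded since print identifies `(C^Λ)^un-tr ⥲ C^ℝ`).
[cite: MochizukiFrdII2008, Thm 3.6 (i) p.36] -/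
theorem C.untr_isOfRationallyStandardType_rsParams (hconn : IsGraphConnected D)
    (hTE : IsTotallyEpimorphic D) (hD : IsOfFSMFFType D) (hrc : RC.IsOfRCIsoSubanchorType (baseRC π)) :
    (PreFrobenioidData.ofFunctor (Φ π)
        (PreFrobenioid.untrFunctor (Ex33ii_isFrobenioid_holds π hconn hTE))).IsOfRationallyStandardType
      (PreFrobenioid.rsParams (PreFrobenioid.isFrobenioid_untr (Ex33ii_isFrobenioid_holds π hconn hTE))
        fun a 𝔭 => PrimarySupp a 𝔭) := by
  obtain ⟨X⟩ := hconn.nonempty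
  exact (FrdI.Prop55Sub.prop55iii_untr_rlf_ratStd'_holds (C.toElem π) (Ex33ii_isFrobenioid_holds π hconn hTE)
    (isPerfFactorialOn_Φ π) (Ex33ii_frobeniusIsotropic_holds π)
    (fun A => (C.isOfFrobeniusNormalizedType π).obj A) (C.not_isOfType_isGroupLikeObj π X)
    (C.isOfRationallyStandardType_rsParams π hconn hTE hD hrc)).1

end ArchFrd

end Literature.AlgebraicGeometry.Frobenioids
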